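import Literature.MathematicalPhysics.QuantumFieldTheory.PolymerReblocking
import HarnessLib

/-!
# Counting fine polymers with prescribed closure; the crude norm bound for a reblocking step

Companion of `PolymerReblocking` (Brydges–Slade V, Prop. 5.1.1). For a blocking map `π : Λ → Λ'`
with fibres `π⁻¹{B'}` of sizes `n_{B'}` and a coarse polymer `U`, the fine polymers `X` with
closure `X̄ = U` are exactly the unions of NON-EMPTY subsets of the fibres over `U`, whence the
two-variable generating identity

  `∑_{X ⊆ π⁻¹U, X̄ = U} a^{|X|} t^{|π⁻¹U ∖ X|} = ∏_{B' ∈ U} ((a + t)^{n_{B'}} − t^{n_{B'}})`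
  (`sum_filter_image_pow_mul_pow_eq_prod`),

and the **crude (entropy-only) bound on the reblocked activity**: if `‖F(B)‖ ≤ t` on `π⁻¹U` and
`‖K(X)‖ ≤ κ a^{|X|}` for the non-empty fine polymers inside `π⁻¹U`, then for `U ≠ ∅`

  `‖reblock π F K (U)‖ ≤ κ ∏_{B' ∈ U} ((t + a)^{n_{B'}} − t^{n_{B'}})`   (`norm_reblock_le_prod`),

e.g. `≤ κ (n a (t+a)^{n-1})^{|U|}` for fibres of size `≤ n` — the loss of a factor `n = L^d` per
coarse block which the renormalisation-group step must recover from the perturbative contraction on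
small sets and from the `η`-inequality on large ones (`CoarseGrainingLargeSets`,
`CoarseGrainingEntropy`); this file supplies only the counting.

## References

* D. C. Brydges, G. Slade, *A renormalisation group method. V. A single renormalisation group
  step*, J. Stat. Phys. 159 (2015) 589–667, §5.1–§5.2. arXiv:1403.7256. [BrydgesSlade2015RGV]
* D. C. Brydges, *Lectures on the renormalisation group*, IAS/Park City Math. Ser. 16, AMS 2009,
  §5. [Brydges2009LecturesRG]
-/

noncomputable section

namespace Literature.MathematicalPhysics.QuantumFieldTheory

open Finset

namespace PolymerActivity

variable {Λ : Type*} [Fintype Λ] [DecidableEq Λ] {Λ' : Type*} [DecidableEq Λ']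
variable {A : Type*} [CommRing A]

/-! ### The two-variable binomial over a set of blocks -/

omit [Fintype Λ] in
/-- `∑_{X ⊆ P} a^{|X|} t^{|P∖X|} = (a + t)^{|P|}` (the binomial lemma `blockProd_add` for constant
block functions). [cite: BrydgesSlade2015RGV, Lemma 1.5.1] -/
theorem sum_powerset_pow_card_mul_pow_card (a t : A) (P : Finset Λ) :
    ∑ X ∈ P.powerset, a ^ X.card * t ^ (P \ X).card = (a + t) ^ P.card := by
  have h := blockProd_add_apply (fun _ : Λ => a) (fun _ : Λ => t) P
  simp only [blockProd_apply, prod_const] at h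
  rw [← h]

omit [Fintype Λ] in
/-- The same sum without the empty polymer: `∑_{∅ ≠ X ⊆ P} a^{|X|} t^{|P∖X|} = (a+t)^{|P|} − t^{|P|}`.
[cite: BrydgesSlade2015RGV, Lemma 1.5.1] -/
theorem sum_powerset_filter_nonempty_pow_card_mul_pow_card (a t : A) (P : Finset Λ) :
    ∑ X ∈ P.powerset.filter (fun X => X.Nonempty), a ^ X.card * t ^ (P \ X).card =
      (a + t) ^ P.card - t ^ P.card := by
  rw [← sum_powerset_pow_card_mul_pow_card a t P, eq_sub_iff_add_eq]
  have hsplit := sum_filter_add_sum_filter_not P.powerset (fun X => X.Nonempty)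
    (fun X => a ^ X.card * t ^ (P \ X).card)
  rw [← hsplit]
  congr 1
  have hset : P.powerset.filter (fun X => ¬ X.Nonempty) = {∅} := by
    ext X
    simp only [mem_filter, mem_powerset, not_nonempty_iff_eq_empty, mem_singleton]
    exact ⟨fun h => h.2, fun h => ⟨h ▸ empty_subset P, h⟩⟩
  rw [hset, sum_singleton]
  simp

/-! ### Fine polymers with prescribed closure -/

omit [DecidableEq Λ] in
/-- Inside one fibre `π⁻¹{B'}`, a fine polymer has closure `{B'}` iff it is non-empty. [cite: BrydgesSlade2015RGV, Def. 1.5.2] -/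
theorem image_eq_singleton_iff_nonempty {π : Λ → Λ'} {B' : Λ'} {X : Finset Λ} (hX : X ⊆ refinement π {B'}) :
    X.image π = {B'} ↔ X.Nonempty := by
  have hsub : X.image π ⊆ {B'} := image_subset_of_subset_refinement hX
  constructor
  · intro h
    have hne : (X.image π).Nonempty := by rw [h]; exact singleton_nonempty B'
    exact image_nonempty.1 hne
  · intro h
    exact (subset_singleton_iff'.1 hsub |> fun hall => eq_singleton_iff_unique_mem.2
      ⟨by obtain ⟨x, hx⟩ := h; have := hall (π x) (mem_image_of_mem π hx); rw [← this]; exact mem_image_of_mem π hx,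
       hall⟩)

/-- **Generating identity for the fine polymers with prescribed closure**:
`∑_{X ⊆ π⁻¹U, X̄ = U} a^{|X|} t^{|π⁻¹U∖X|} = ∏_{B' ∈ U} ((a + t)^{|π⁻¹{B'}|} − t^{|π⁻¹{B'}|})` — a fine polymer
with closure `U` is a union of non-empty subsets of the fibres over `U`, chosen independently.
[cite: BrydgesSlade2015RGV, §5.1] -/
theorem sum_filter_image_pow_mul_pow_eq_prod (π : Λ → Λ') (a t : A) (U : Finset Λ') :
    ∑ X ∈ (refinement π U).powerset.filter (fun X => X.image π = U),
      a ^ X.card * t ^ (refinement π U \ X).card =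
      ∏ B' ∈ U, ((a + t) ^ (refinement π {B'}).card - t ^ (refinement π {B'}).card) := by
  induction U using Finset.induction_on with
  | empty =>
    rw [prod_empty, refinement_empty, Finset.powerset_empty, Finset.filter_singleton, if_pos (by simp),
      sum_singleton]
    simp
  | @insert B' U hB' ih =>
    rw [prod_insert hB', ← ih, ← sum_powerset_filter_nonempty_pow_card_mul_pow_card]
    have hdisj : Disjoint ({B'} : Finset Λ') U := disjoint_singleton_left.2 hB'
    have hP : Disjoint (refinement π {B'}) (refinement π U) := disjoint_refinement π hdisj
    rw [insert_eq, refinement_union]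
    refine sum_powerset_union_filter_eq_mul hP (fun X => X.image π = {B'} ∪ U) (fun X => X.Nonempty)
      (fun X => X.image π = U) _ _ _ (fun X₁ hX₁ X₂ hX₂ => ?_) (fun X₁ hX₁ X₂ hX₂ _ _ => ?_)
    · rw [image_union, union_eq_union_iff_of_subset hdisj (image_subset_of_subset_refinement hX₁)
        (image_subset_of_subset_refinement hX₂), image_eq_singleton_iff_nonempty hX₁]
    · rw [union_sdiff_union_of_subset hP hX₁ hX₂, card_union_of_disjoint (hP.mono hX₁ hX₂),
        card_union_of_disjoint (hP.mono sdiff_subset sdiff_subset), pow_add, pow_add, mul_mul_mul_comm]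

/-- The special case `t = 1`: `∑_{X̄ = U} a^{|X|} = ∏_{B' ∈ U} ((a + 1)^{|π⁻¹{B'}|} − 1)`.
[cite: BrydgesSlade2015RGV, §5.1] -/
theorem sum_filter_image_pow_eq_prod (π : Λ → Λ') (a : A) (U : Finset Λ') :
    ∑ X ∈ (refinement π U).powerset.filter (fun X => X.image π = U), a ^ X.card =
      ∏ B' ∈ U, ((a + 1) ^ (refinement π {B'}).card - 1) := by
  have h := sum_filter_image_pow_mul_pow_eq_prod π a 1 U
  simp only [one_pow, mul_one] at h
  exact h

/-! ### The crude norm bound for the reblocked activity -/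

/-- **Entropy-only bound for a reblocking step.** If `‖F(B)‖ ≤ t` for the fine blocks over `U` and
`‖K(X)‖ ≤ κ a^{|X|}` for the non-empty fine polymers inside `π⁻¹U` (`t ≥ 0`), then for a
non-empty coarse polymer `U`,
`‖reblock π F K (U)‖ ≤ κ ∏_{B' ∈ U} ((t + a)^{|π⁻¹{B'}|} − t^{|π⁻¹{B'}|})`.
For fibres of size `n` and `t = 1` this is `κ((1+a)ⁿ − 1)^{|U|} ≤ κ(n a (1+a)^{n−1})^{|U|}`: the
geometric decay rate in the number of blocks degrades by the factor `n = L^d` per step unless the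
contraction of `a` compensates. [cite: BrydgesSlade2015RGV, §5.2] -/
theorem norm_reblock_le_prod {𝕜 : Type*} [NormedCommRing 𝕜] [NormOneClass 𝕜] (π : Λ → Λ') {F : Λ → 𝕜}
    {K : PolymerActivity Λ 𝕜} {U : Finset Λ'} {t a κ : ℝ} (ht : 0 ≤ t) (hU : U.Nonempty) (hF : ∀ B ∈ refinement π U, ‖F B‖ ≤ t)
    (hK : ∀ X ⊆ refinement π U, X.Nonempty → ‖K X‖ ≤ κ * a ^ X.card) :
    ‖reblock π F K U‖ ≤ κ * ∏ B' ∈ U, ((t + a) ^ (refinement π {B'}).card - t ^ (refinement π {B'}).card) := by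
  refine (norm_reblock_le π F K U).trans ?_
  have hterm : ∀ X ∈ (refinement π U).powerset.filter (fun X => X.image π = U),
      (∏ B ∈ refinement π U \ X, ‖F B‖) * ‖K X‖ ≤ κ * (a ^ X.card * t ^ (refinement π U \ X).card) := by
    intro X hX
    obtain ⟨hXU, hcl⟩ := mem_filter.1 hX
    have hXU' : X ⊆ refinement π U := mem_powerset.1 hXU
    have hXne : X.Nonempty := by
      have hne : (X.image π).Nonempty := by rw [hcl]; exact hU
      exact image_nonempty.1 hne
    have h1 : ∏ B ∈ refinement π U \ X, ‖F B‖ ≤ t ^ (refinement π U \ X).card := by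
      rw [← prod_const]
      exact prod_le_prod (fun _ _ => norm_nonneg _) fun B hB => hF B (mem_sdiff.1 hB).1
    calc (∏ B ∈ refinement π U \ X, ‖F B‖) * ‖K X‖
        ≤ t ^ (refinement π U \ X).card * (κ * a ^ X.card) :=
          mul_le_mul h1 (hK X hXU' hXne) (norm_nonneg _) (pow_nonneg ht _)
      _ = κ * (a ^ X.card * t ^ (refinement π U \ X).card) := by ring
  refine (sum_le_sum hterm).trans ?_
  rw [← mul_sum, sum_filter_image_pow_mul_pow_eq_prod π a t U, add_comm a t]

end PolymerActivity

end Literature.MathematicalPhysics.QuantumFieldTheory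

end
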